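import Summits.QuantumFields.YangMills.Theorems.BalabanUVNodesN15CurvedGluingCubeSmoothCutDressedRemainder
import Summits.QuantumFields.YangMills.Theorems.BalabanUVNodesN15CurvedGluingCubeDressedTail
import Summits.QuantumFields.YangMills.Theorems.BalabanUVNodesN15CurvedGluingCubeDefectGluing
import HarnessLib

/-!
# Route «BalabanUVNodes» (cluster K4 «SpineRates»), Track-A DAG node N15 = NE2, BACKGROUND LAYER — THE GLUED LIVE-BACKGROUND PROPAGATOR FROM DRESSED SMOOTH-CUT CUBES, ONE GRID:
# file 32's gluing-with-defects run on a FAMILY of dressed smooth-cut cubes `X_□ = pr₀X̂_□`, every per-cube row supplied BY NAME (file 34 cut letter, file 38 remainder row, file 33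
# locality-with-defect and tail letter) — `(Σ∇*∇ + W + N_L − 𝒱)∘𝒢 = 1 = 𝒢∘(Σ∇*∇ + W + N_L − 𝒱)` and `𝒢 ≤ N_ovβ̄′(1 − N_ov(θ₀ + ε̄)c_r)⁻¹c_r·e^{−(ρ₃−σ)d}` from FILE 63's cut rows, the bumps, the
# partition, the tail rows and the letters of `V̂, W, N_L`

Cell `pub-ymgap`, seat `pub-ymgap-dag-n15-w3` (WIDTH SEAT 3∕3 on node N15, director-ym №197 ∕ HUMAN RULING D-0149; plan `W-SEAT-START-LIST.md` §n15 item 3 «LG-vector + background layers at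
GENERAL small-field U» — forty-fourth piece).  `bears_on: R4∕N15 · K3⁸ SpineGivenEndpointR13SepCoPHV (stmt-QuantumFields-27366; K3⁷ 20544 aside — KEY MAP v2)`.  Filed `--kind proof --supports
stmt-QuantumFields-27366 --as helper` — COUNT-NEUTRAL.  Theorems only; 0 `sorry`.  Imports BY NAME files 38 `…SmoothCutDressedRemainder` (through it 34∕31 and dag-n15-w4's row), 33
`…CubeDressedTail`, 32 `…CubeDefectGluing` (through it dag-n15-c's FILE 63 and FILES 43∕44); nothing in the tree is modified.

WHAT.  Cubes `□ = k : K` with flat cube operators `N_k` (dag-n15-a's Neumann cubes in the knit), sharp cuts `χ_k`, bumps `χ̃_k`, input cuts `ψ_k`, reaches `S_k`, a quadratic partition `h_k`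
(`Σ_k h_k² = 1`, `M_{h_k}M_{χ_k} = M_{h_k}`); ONE perturbation `V̂` of the jet (Bałaban's `V(A)`: species + `P₁(A)`), local part `W`, flat nonlocal summand `N_L`; the live operator
`Δ_U := Σ_μ∇*_μ∇_μ + W + N_L − V̂∘jet`; the dressed smooth-cut cubes `X_k := pr₀((1 − Ŝ_kV̂)⁻¹Ŝ_k)`, `Ŝ_k = stack(M_{χ̃_k}N_k, ∇(M_{χ̃_k}N_k))`; the locality defects
`E_k := ((−M_{h_k}N_LM_{1−χ̃_k})N_k)(1 + V̂∘jet∘X_k)` (file 33); the glued operator `𝒢 := glueInv (Σ_k X_kM_{h_k}) (R − Σ_k E_kM_{h_k})` (FILE 43∕file 32).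
* ★★★ `hasMaj_glueInv_smoothCutDressed` — the DECAY LETTER of `𝒢` (file 32 `hasMaj_glued_of_cutRows_defect` fed by file 34 ★★★ `hasMaj_smoothCutDressed_loc₂` + `mulOp_comp_smoothCutDressed`,
  file 38 ★★★ `hasMaj_commOp_cubeOp_smoothCutDressed_in`, file 33 ★★ `hasMaj_dressedTail_out`, all weakened to the common rate `ρ₃`);
* ★★★ `glueInv_smoothCutDressed_inverse` — `𝒢∘Δ_U = 1 ∧ Δ_U∘𝒢 = 1` (file 32 `glued_inverse_of_defect` with file 33's `mulOp_comp_sub_comp_dressedV_tail` as the per-cube locality-with-defect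
  and file 32 `hasMaj_remainderD`).
What stays DISPLAYED (all located): FILE 63's cut rows `β, β₁` of `N_k` (dag-n15-a N-IIIb∕c), the exact flat locality `M_{h_k}ΔN_k = M_{h_k}` (N-IIIa), the tail rows `ε₀e^{−ρ_Td}` (images
geometry ∕ FILE 68), `M_{h_k}(Σ∇*∇ + W)M_{1−χ̃_k} = 0` (plateau of the bump), the bumps' letters∕insertions, the partition's letters (FILE 67), the `W`-rows, `[N_L, M_{h_k}]`'s letter, `V̂`'s
letter `Re^{−δ_Vd}`, and the TWO smallness conditions `β̄Rc_r² < 1`, `N_ov(θ₀ + ε̄)c_r < 1`.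

HONEST FRAMING ∕ LIMITS.  Composition of LANDED theorems over DISPLAYED rows — the operator-level content of NE2 «the random-walk expansion converges for the covariant Laplacian in a small
field» as a CONDITIONAL statement on King's ∕ dag-n15-a's model carriers; nothing of [B5]∕[B6]∕[B9] asserted ((1.120)–(1.128) pp.37–38, (2.91)–(2.92) p.239, (2.133)–(2.136) p.247,
(3.62)–(3.65) pp.402–403 = SHAPES ∕ MECHANISM); the tree's concrete propagator objects are `U ≡ 1` models, so at a genuine non-abelian `U` every row here is MODEL-LEVEL until the transporter
letters inhabit `V̂`.  NE2⁺ NOT PRINTED, NOT proved; N15 NOT discharged; counts of record UNMOVED (typed 28∕28 · discharged 5∕27); one finite 𝕋⁴ at fixed ε — NOT infinite volume, NOT OS on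
ℝ⁴, NOT a mass gap, NOT Clay; R4 closes the conditional finite-𝕋⁴ rung `BalabanLadder.UV` only.
-/

set_option autoImplicit false

noncomputable section
open scoped BigOperators
open Finset

namespace Summit.QuantumFields.YangMills.BalabanUVNodes.N15.CurvedSpecies

open Literature.MathematicalPhysics.QuantumFieldTheory.Balaban1983to89
open Literature.MathematicalPhysics.QuantumFieldTheory.Balaban1983to89.B11SectG (BlockNorm HasMaj RowSum)
open Literature.MathematicalPhysics.QuantumFieldTheory.Balaban1983to89.B6RandomWalk (Triangle254)
open Literature.MathematicalPhysics.QuantumFieldTheory.Balaban1983to89.B6Prop26Gluing (mulOp mulOp_apply ind ind_nonneg ind_le_one)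
open Summit.QuantumFields.YangMills.BalabanUVNodes.N15.MatrixSpecies (liftBlk liftEquiv liftEquiv_apply liftEquiv_symm_apply)
open Summit.QuantumFields.YangMills.BalabanUVNodes.N15.BackgroundLayer (fgrad bgrad fgradAdj stack projO blkPair bgPropV)
open Summit.QuantumFields.YangMills.BalabanUVNodes.N15.Gluing (commOp lapOp parametrix remainder glueInv)

variable {X ι J K : Type} [Fintype X] [DecidableEq X] [Fintype ι] [DecidableEq ι] [Fintype J] [DecidableEq J] [Fintype K] {g : B6.Geometry} (blk : X → g.Site) (τ : J → X ≃ X) (n : ℝ)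
  {σ cr : ℝ} {N : K → (X × ι → ℝ) →ₗ[ℝ] (X × ι → ℝ)} {V : ((X × ι) × Option (J ⊕ J) → ℝ) →ₗ[ℝ] (X × ι → ℝ)} {W NL : (X × ι → ℝ) →ₗ[ℝ] (X × ι → ℝ)} {χX χtX ψX : K → X → ℝ}
  {Sk : K → Set g.Site} {h : K → X × ι → ℝ} {hb : K → g.Site → ℝ} {β β₁ ct δ : ℝ}

omit [Fintype X] [DecidableEq X] [Fintype ι] [DecidableEq ι] [Fintype J] [DecidableEq J] [Fintype K] in
/-- Weakening the rate of a localized letter: `0 ≤ c`, `ρ′ ≤ ρ`, `d ≥ 0` ⟹ `w·c·e^{−ρd} ≤ w·c·e^{−ρ′d}` for any weight `w ≥ 0`. [folklore] -/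
theorem weight_mul_exp_rate_mono {w c ρ ρ' : ℝ} (hw : 0 ≤ w) (hc : 0 ≤ c) (hρ : ρ' ≤ ρ) {a b : g.Site} (hd : 0 ≤ g.dist a b) :
    w * (c * Real.exp (-(ρ * g.dist a b))) ≤ w * (c * Real.exp (-(ρ' * g.dist a b))) :=
  mul_le_mul_of_nonneg_left (mul_le_mul_of_nonneg_left (Real.exp_le_exp.mpr (by nlinarith)) hc) hw

/-- ★★★ **THE GLUED LIVE-BACKGROUND PROPAGATOR DECAYS** (one grid): for the family of dressed smooth-cut cubes `X_k` with locality defects `E_k`, under the displayed per-cube rows (FILE 63's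
cut rows `β, β₁`, bumps + insertions, input cuts, partition `h_k` with letters `c₁, c₂`, block reading `ℓ, ω`, one-step block distance `d₁`, the `W`-rows `θ_W`, `[N_L, M_{h_k}] ≤ c_Ne^{−ρ_Nd}`,
the tail rows `ε₀e^{−ρ_Td}`), `V̂ ≤ Re^{−δ_Vd}`, overlap `N_ov`, `β̄Rc_r² < 1` and `N_ov(θ₀ + ε̄)c_r < 1` (`θ₀` = file 38's constant, `ε̄ = ε₀(1 − β̄Rc_r²)⁻¹`):
`𝒢 ≤ N_ov·β̄(1 − β̄Rc_r²)⁻¹·(1 − N_ov(θ₀ + ε̄)c_r)⁻¹·c_r·e^{−(ρ₃−σ)d}`.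
[cite: Balaban1984PropagatorsII, (2.91) p.239, (2.133)–(2.136) p.247 (mechanism); Balaban1985BackgroundPropagators, (3.62)–(3.65) pp.402–403, p.399 (architecture)] -/
theorem hasMaj_glueInv_smoothCutDressed (htri : Triangle254 g) (hd : ∀ a b : g.Site, 0 ≤ g.dist a b) (hd0 : ∀ y : g.Site, g.dist y y = 0) (hsymm : ∀ y y', g.dist y y' = g.dist y' y)
    (hrow : RowSum g σ cr) (hσ : 0 ≤ σ) {ρ₁ ρ₂ ρ₃ ρN ρT δV ε R ε₀ c₁ c₂ θW cN ℓ ω d₁ Nov : ℝ} (hβ : 0 ≤ β) (hβ₁ : 0 ≤ β₁) (hct : 0 ≤ ct) (hR : 0 ≤ R) (hε₀ : 0 ≤ ε₀) (hcr : 0 ≤ cr) (hNov : 0 ≤ Nov) (hσρ : σ ≤ ρ₁) (hρ₁V : ρ₁ ≤ δV)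
    (hρ₁G : ρ₁ + σ ≤ δ) (hρ₂ : 0 ≤ ρ₂) (hρ₂₁ : ρ₂ + σ ≤ ρ₁) (hρ₂T : ρ₂ + σ ≤ ρT) (hρ₃ : 0 ≤ ρ₃) (hρ₃₂ : ρ₃ ≤ ρ₂) (hρ₃V : ρ₃ + σ ≤ δV - ε) (hρ₃N : ρ₃ + σ ≤ ρN) (hσρ₃ : 2 * σ ≤ ρ₃)
    (hε : 0 < ε) (hc₁ : 0 ≤ c₁) (hc₂ : 0 ≤ c₂) (hθW : 0 ≤ θW) (hcN : 0 ≤ cN) (hℓ : 0 ≤ ℓ) (hω : 0 ≤ ω) (hd₁ : 0 ≤ d₁)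
    -- per cube: supports, the bump and its insertions (both ways), the input cut-off
    (hSχ : ∀ k x, χX k x ≠ 0 → blk x ∈ Sk k) (hSψ : ∀ k x, ψX k x ≠ 0 → blk x ∈ Sk k) (hχt : ∀ k x, |χtX k x| ≤ 1)
    (hdχt : ∀ k μ p, |fgrad n (liftEquiv (τ μ) ι) (fun p : X × ι => χtX k p.1) p| ≤ ct) (hdχtb : ∀ k μ p, |bgrad n (liftEquiv (τ μ) ι) (fun p : X × ι => χtX k p.1) p| ≤ ct)
    (hsub : ∀ k, mulOp (fun p : X × ι => χtX k p.1) ∘ₗ mulOp (fun p : X × ι => χX k p.1) = mulOp (fun p : X × ι => χtX k p.1))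
    (hχ : ∀ k, mulOp (fun p : X × ι => χX k p.1) ∘ₗ mulOp (fun p : X × ι => χtX k p.1) = mulOp (fun p : X × ι => χtX k p.1))
    (hs : ∀ k μ, mulOp ((fun p : X × ι => χtX k p.1) ∘ (liftEquiv (τ μ) ι)) ∘ₗ mulOp (fun p : X × ι => χX k p.1) = mulOp ((fun p : X × ι => χtX k p.1) ∘ (liftEquiv (τ μ) ι)))
    (hsb : ∀ k μ, mulOp ((fun p : X × ι => χtX k p.1) ∘ (liftEquiv (τ μ) ι).symm) ∘ₗ mulOp (fun p : X × ι => χX k p.1) = mulOp ((fun p : X × ι => χtX k p.1) ∘ (liftEquiv (τ μ) ι).symm))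
    (hdd : ∀ k μ, mulOp (fgrad n (liftEquiv (τ μ) ι) (fun p : X × ι => χtX k p.1)) ∘ₗ mulOp (fun p : X × ι => χX k p.1) = mulOp (fgrad n (liftEquiv (τ μ) ι) (fun p : X × ι => χtX k p.1)))
    (hddb : ∀ k μ, mulOp (bgrad n (liftEquiv (τ μ) ι) (fun p : X × ι => χtX k p.1)) ∘ₗ mulOp (fun p : X × ι => χX k p.1) = mulOp (bgrad n (liftEquiv (τ μ) ι) (fun p : X × ι => χtX k p.1)))
    (hs' : ∀ k μ, mulOp (fun p : X × ι => χX k p.1) ∘ₗ mulOp ((fun p : X × ι => χtX k p.1) ∘ (liftEquiv (τ μ) ι)) = mulOp ((fun p : X × ι => χtX k p.1) ∘ (liftEquiv (τ μ) ι)))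
    (hsb' : ∀ k μ, mulOp (fun p : X × ι => χX k p.1) ∘ₗ mulOp ((fun p : X × ι => χtX k p.1) ∘ (liftEquiv (τ μ) ι).symm) = mulOp ((fun p : X × ι => χtX k p.1) ∘ (liftEquiv (τ μ) ι).symm))
    (hdd' : ∀ k μ, mulOp (fun p : X × ι => χX k p.1) ∘ₗ mulOp (fgrad n (liftEquiv (τ μ) ι) (fun p : X × ι => χtX k p.1)) = mulOp (fgrad n (liftEquiv (τ μ) ι) (fun p : X × ι => χtX k p.1)))
    (hddb' : ∀ k μ, mulOp (fun p : X × ι => χX k p.1) ∘ₗ mulOp (bgrad n (liftEquiv (τ μ) ι) (fun p : X × ι => χtX k p.1)) = mulOp (bgrad n (liftEquiv (τ μ) ι) (fun p : X × ι => χtX k p.1)))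
    (hNψ : ∀ k, N k ∘ₗ mulOp (fun p : X × ι => ψX k p.1) = N k)
    -- per cube: FILE 63's cut rows
    (hcut : ∀ k, HasMaj (BlockNorm.ofBlocks g (liftBlk blk ι)) (BlockNorm.ofBlocks g (liftBlk blk ι)) (mulOp (fun p : X × ι => χX k p.1) ∘ₗ N k) (fun y y' => ind (Sk k) y * ind (Sk k) y' * (β * Real.exp (-(δ * g.dist y y')))))
    (hcutF : ∀ k μ, HasMaj (BlockNorm.ofBlocks g (liftBlk blk ι)) (BlockNorm.ofBlocks g (liftBlk blk ι)) (mulOp (fun p : X × ι => χX k p.1) ∘ₗ (fgrad n (liftEquiv (τ μ) ι) ∘ₗ N k)) (fun y y' => ind (Sk k) y * ind (Sk k) y' * (β₁ * Real.exp (-(δ * g.dist y y')))))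
    (hcutB : ∀ k μ, HasMaj (BlockNorm.ofBlocks g (liftBlk blk ι)) (BlockNorm.ofBlocks g (liftBlk blk ι)) (mulOp (fun p : X × ι => χX k p.1) ∘ₗ (bgrad n (liftEquiv (τ μ) ι) ∘ₗ N k)) (fun y y' => ind (Sk k) y * ind (Sk k) y' * (β₁ * Real.exp (-(δ * g.dist y y')))))
    -- per cube: the partition (`|h| ≤ 1`, `Σh² = 1`, supported in the cut: `M_hM_χ = M_h`, letters `c₁, c₂`, block reading `hb` with `ℓ, ω`), one-step block distance `d₁`, overlap `N_ov`
    (hhabs : ∀ k p, |h k p| ≤ 1) (hhcut : ∀ k, mulOp (h k) ∘ₗ mulOp (fun p : X × ι => χX k p.1) = mulOp (h k))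
    (hh1 : ∀ k μ p, |fgrad n (liftEquiv (τ μ) ι) (h k) p| ≤ c₁) (hh1b : ∀ k μ p, |bgrad n (liftEquiv (τ μ) ι) (h k) p| ≤ c₁) (hh2 : ∀ k μ p, |fgradAdj n (liftEquiv (τ μ) ι) (fgrad n (liftEquiv (τ μ) ι) (h k)) p| ≤ c₂)
    (hLip : ∀ k y y', |hb k y - hb k y'| ≤ ℓ * g.dist y y') (hrh : ∀ k p, |h k p - hb k (liftBlk blk ι p)| ≤ ω) (hstep : ∀ μ x, g.dist (blk (τ μ x)) (blk x) ≤ d₁)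
    (hN : ∀ a, ∑ k, ind (Sk k) a ≤ Nov)
    -- per cube: the tail row (dag-n15-a's images geometry ∕ FILE 68's far sandwich)
    (hT : ∀ k, HasMaj (BlockNorm.ofBlocks g (liftBlk blk ι)) (BlockNorm.ofBlocks g (liftBlk blk ι)) ((-(mulOp (h k) ∘ₗ NL ∘ₗ mulOp (1 - fun p : X × ι => χtX k p.1))) ∘ₗ N k) (fun y y' => ind (Sk k) y * ind (Sk k) y' * (ε₀ * Real.exp (-(ρT * g.dist y y')))))
    -- common: the perturbation `V̂`, smallness, the `W`-rows per cube, the flat nonlocal summand's commutator letters per cube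
    (hV : HasMaj (BlockNorm.ofBlocks g (blkPair (liftBlk blk ι))) (BlockNorm.ofBlocks g (liftBlk blk ι)) V (fun y y' => R * Real.exp (-(δV * g.dist y y'))))
    (hq : (β + (β₁ + ct * β)) * (R * cr) * cr < 1)
    (hW : ∀ k, HasMaj (BlockNorm.ofBlocks g (liftBlk blk ι)) (BlockNorm.ofBlocks g (liftBlk blk ι)) (commOp W (h k) ∘ₗ (projO none ∘ₗ bgPropV (stack (mulOp (fun p : X × ι => χtX k p.1) ∘ₗ N k)
          (fun j => Sum.elim (fun μ => fgrad n (liftEquiv (τ μ) ι)) (fun μ => bgrad n (liftEquiv (τ μ) ι)) j ∘ₗ (mulOp (fun p : X × ι => χtX k p.1) ∘ₗ N k))) V))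
      (fun y y' => ind (Sk k) y * ind (Sk k) y' * (θW * Real.exp (-(ρ₂ * g.dist y y')))))
    (hKN : ∀ k, HasMaj (BlockNorm.ofBlocks g (liftBlk blk ι)) (BlockNorm.ofBlocks g (liftBlk blk ι)) (commOp NL (h k)) (fun y y' => cN * Real.exp (-(ρN * g.dist y y'))))
    (hq' : Nov * ((((Fintype.card J : ℝ) * (c₂ * ((β + (β₁ + ct * β)) * (1 - (β + (β₁ + ct * β)) * (R * cr) * cr)⁻¹) + 2 * (c₁ * ((β + (β₁ + ct * β)) * (1 - (β + (β₁ + ct * β)) * (R * cr) * cr)⁻¹))) + θW + cN * ((β + (β₁ + ct * β)) * (1 - (β + (β₁ + ct * β)) * (R * cr) * cr)⁻¹) * cr)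
          + ((ℓ * (Real.exp 1 * ε)⁻¹ + 2 * (ω + ℓ * d₁)) * R * ((β + (β₁ + ct * β)) * (1 - (β + (β₁ + ct * β)) * (R * cr) * cr)⁻¹) * cr + R * c₁ * ((β + (β₁ + ct * β)) * (1 - (β + (β₁ + ct * β)) * (R * cr) * cr)⁻¹) * cr)) + (ε₀ * (1 - (β + (β₁ + ct * β)) * (R * cr) * cr)⁻¹)) * cr < 1) :
    HasMaj (BlockNorm.ofBlocks g (liftBlk blk ι)) (BlockNorm.ofBlocks g (liftBlk blk ι))
      (glueInv (parametrix h (fun k => projO none ∘ₗ bgPropV (stack (mulOp (fun p : X × ι => χtX k p.1) ∘ₗ N k)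
          (fun j => Sum.elim (fun μ => fgrad n (liftEquiv (τ μ) ι)) (fun μ => bgrad n (liftEquiv (τ μ) ι)) j ∘ₗ (mulOp (fun p : X × ι => χtX k p.1) ∘ₗ N k))) V))
        (remainder (lapOp n (fun μ => liftEquiv (τ μ) ι) W + NL - V ∘ₗ stack LinearMap.id (fun j => Sum.elim (fun μ => fgrad n (liftEquiv (τ μ) ι)) (fun μ => bgrad n (liftEquiv (τ μ) ι)) j)) h (fun k => projO none ∘ₗ bgPropV (stack (mulOp (fun p : X × ι => χtX k p.1) ∘ₗ N k)
          (fun j => Sum.elim (fun μ => fgrad n (liftEquiv (τ μ) ι)) (fun μ => bgrad n (liftEquiv (τ μ) ι)) j ∘ₗ (mulOp (fun p : X × ι => χtX k p.1) ∘ₗ N k))) V)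
          - ∑ k, (fun k => ((-(mulOp (h k) ∘ₗ NL ∘ₗ mulOp (1 - fun p : X × ι => χtX k p.1))) ∘ₗ N k) ∘ₗ
          (LinearMap.id + (V ∘ₗ stack LinearMap.id (fun j => Sum.elim (fun μ => fgrad n (liftEquiv (τ μ) ι)) (fun μ => bgrad n (liftEquiv (τ μ) ι)) j)) ∘ₗ (projO none ∘ₗ bgPropV (stack (mulOp (fun p : X × ι => χtX k p.1) ∘ₗ N k)
          (fun j => Sum.elim (fun μ => fgrad n (liftEquiv (τ μ) ι)) (fun μ => bgrad n (liftEquiv (τ μ) ι)) j ∘ₗ (mulOp (fun p : X × ι => χtX k p.1) ∘ₗ N k))) V))) k ∘ₗ mulOp (h k)))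
      (fun y y' => Nov * ((β + (β₁ + ct * β)) * (1 - (β + (β₁ + ct * β)) * (R * cr) * cr)⁻¹) * (1 - Nov * ((((Fintype.card J : ℝ) * (c₂ * ((β + (β₁ + ct * β)) * (1 - (β + (β₁ + ct * β)) * (R * cr) * cr)⁻¹) + 2 * (c₁ * ((β + (β₁ + ct * β)) * (1 - (β + (β₁ + ct * β)) * (R * cr) * cr)⁻¹))) + θW + cN * ((β + (β₁ + ct * β)) * (1 - (β + (β₁ + ct * β)) * (R * cr) * cr)⁻¹) * cr)
          + ((ℓ * (Real.exp 1 * ε)⁻¹ + 2 * (ω + ℓ * d₁)) * R * ((β + (β₁ + ct * β)) * (1 - (β + (β₁ + ct * β)) * (R * cr) * cr)⁻¹) * cr + R * c₁ * ((β + (β₁ + ct * β)) * (1 - (β + (β₁ + ct * β)) * (R * cr) * cr)⁻¹) * cr)) + (ε₀ * (1 - (β + (β₁ + ct * β)) * (R * cr) * cr)⁻¹)) * cr)⁻¹ * cr * Real.exp (-((ρ₃ - σ) * g.dist y y'))) := by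
  have hβb : 0 ≤ (β + (β₁ + ct * β)) := by positivity
  have hqi : 0 ≤ (1 - (β + (β₁ + ct * β)) * (R * cr) * cr)⁻¹ := inv_nonneg.2 (by linarith)
  have hB : 0 ≤ ((β + (β₁ + ct * β)) * (1 - (β + (β₁ + ct * β)) * (R * cr) * cr)⁻¹) := mul_nonneg hβb hqi
  have hθ : 0 ≤ (((Fintype.card J : ℝ) * (c₂ * ((β + (β₁ + ct * β)) * (1 - (β + (β₁ + ct * β)) * (R * cr) * cr)⁻¹) + 2 * (c₁ * ((β + (β₁ + ct * β)) * (1 - (β + (β₁ + ct * β)) * (R * cr) * cr)⁻¹))) + θW + cN * ((β + (β₁ + ct * β)) * (1 - (β + (β₁ + ct * β)) * (R * cr) * cr)⁻¹) * cr)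
          + ((ℓ * (Real.exp 1 * ε)⁻¹ + 2 * (ω + ℓ * d₁)) * R * ((β + (β₁ + ct * β)) * (1 - (β + (β₁ + ct * β)) * (R * cr) * cr)⁻¹) * cr + R * c₁ * ((β + (β₁ + ct * β)) * (1 - (β + (β₁ + ct * β)) * (R * cr) * cr)⁻¹) * cr)) := by positivity
  have hε' : 0 ≤ (ε₀ * (1 - (β + (β₁ + ct * β)) * (R * cr) * cr)⁻¹) := mul_nonneg hε₀ hqi
  -- files 31∕34: flat letters of each smooth-cut cube and its jet; file 23: the Neumann series is summable
  have hG := fun k => hasMaj_smoothCut_flat blk (S := Sk k) hβ hβ₁ hct (hχt k) (hsub k) (hcut k)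
  have hD := fun k => hasMaj_jet_smoothCut_flat blk τ n (S := Sk k) hβ hβ₁ hct (hχt k) (hdχt k) (hdχtb k) (hs k) (hsb k) (hdd k) (hddb k) (hcut k) (hcutF k) (hcutB k)
  have hunit := fun k => (hasMaj_dressedV_pair blk htri hd hrow hσ hβb hR hcr hσρ hρ₁V hρ₁G hρ₂ hρ₂₁ (hG k) (hD k) hV hq).1
  -- file 34: the cut letter of each dressed cube (two-sided; `M_χX = X`), weakened to the rate `ρ₃`
  have hGc : ∀ k, HasMaj (BlockNorm.ofBlocks g (liftBlk blk ι)) (BlockNorm.ofBlocks g (liftBlk blk ι)) (mulOp (fun p : X × ι => χX k p.1) ∘ₗ (projO none ∘ₗ bgPropV (stack (mulOp (fun p : X × ι => χtX k p.1) ∘ₗ N k)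
          (fun j => Sum.elim (fun μ => fgrad n (liftEquiv (τ μ) ι)) (fun μ => bgrad n (liftEquiv (τ μ) ι)) j ∘ₗ (mulOp (fun p : X × ι => χtX k p.1) ∘ₗ N k))) V))
      (fun y y' => ind (Sk k) y * ind (Sk k) y' * (((β + (β₁ + ct * β)) * (1 - (β + (β₁ + ct * β)) * (R * cr) * cr)⁻¹) * Real.exp (-(ρ₃ * g.dist y y')))) := fun k => by
    rw [mulOp_comp_smoothCutDressed τ n (hχ k) (hNψ k) (hunit k)]
    exact (hasMaj_smoothCutDressed_loc₂ blk τ n htri hd hrow hσ hβ hβ₁ hct hR hcr hσρ hρ₁V hρ₁G hρ₂ hρ₂₁ (hSχ k) (hSψ k) (hχt k) (hdχt k) (hdχtb k) (hsub k) (hχ k) (hs k)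
      (hsb k) (hdd k) (hddb k) (hNψ k) (hcut k) (hcutF k) (hcutB k) hV hq).mono fun y y' =>
        weight_mul_exp_rate_mono (mul_nonneg (ind_nonneg _ _) (ind_nonneg _ _)) hB hρ₃₂ (hd y y')
  -- file 38: the input-localized remainder row of each dressed cube (dag-n15-w4's row), at the rate `ρ₃`
  have hK : ∀ k, HasMaj (BlockNorm.ofBlocks g (liftBlk blk ι)) (BlockNorm.ofBlocks g (liftBlk blk ι)) (commOp (lapOp n (fun μ => liftEquiv (τ μ) ι) W + NL - V ∘ₗ stack LinearMap.id (fun j => Sum.elim (fun μ => fgrad n (liftEquiv (τ μ) ι)) (fun μ => bgrad n (liftEquiv (τ μ) ι)) j)) (h k) ∘ₗ (projO none ∘ₗ bgPropV (stack (mulOp (fun p : X × ι => χtX k p.1) ∘ₗ N k)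
          (fun j => Sum.elim (fun μ => fgrad n (liftEquiv (τ μ) ι)) (fun μ => bgrad n (liftEquiv (τ μ) ι)) j ∘ₗ (mulOp (fun p : X × ι => χtX k p.1) ∘ₗ N k))) V))
      (fun y y' => ind (Sk k) y' * ((((Fintype.card J : ℝ) * (c₂ * ((β + (β₁ + ct * β)) * (1 - (β + (β₁ + ct * β)) * (R * cr) * cr)⁻¹) + 2 * (c₁ * ((β + (β₁ + ct * β)) * (1 - (β + (β₁ + ct * β)) * (R * cr) * cr)⁻¹))) + θW + cN * ((β + (β₁ + ct * β)) * (1 - (β + (β₁ + ct * β)) * (R * cr) * cr)⁻¹) * cr)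
          + ((ℓ * (Real.exp 1 * ε)⁻¹ + 2 * (ω + ℓ * d₁)) * R * ((β + (β₁ + ct * β)) * (1 - (β + (β₁ + ct * β)) * (R * cr) * cr)⁻¹) * cr + R * c₁ * ((β + (β₁ + ct * β)) * (1 - (β + (β₁ + ct * β)) * (R * cr) * cr)⁻¹) * cr)) * Real.exp (-(ρ₃ * g.dist y y')))) := fun k =>
    hasMaj_commOp_cubeOp_smoothCutDressed_in blk τ n htri hd hsymm hrow hσ hβ hβ₁ hct hR hcr hσρ hρ₁V hρ₁G hρ₂ hρ₂₁ hρ₃ hρ₃₂ hρ₃V hρ₃N hε hc₁ hc₂ hθW hcN hℓ hω hd₁ (hSχ k)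
      (hSψ k) (hχt k) (hdχt k) (hdχtb k) (hsub k) (hχ k) (hs k) (hsb k) (hdd k) (hddb k) (hs' k) (hsb' k) (hdd' k) (hddb' k) (hNψ k) (hcut k) (hcutF k) (hcutB k) hV hq
      (hh1 k) (hh1b k) (hh2 k) (hLip k) (hrh k) hstep (hW k) (hKN k)
  -- file 33: the locality defect's letter of each dressed cube (output-localized), weakened to the rate `ρ₃`
  have hE : ∀ k, HasMaj (BlockNorm.ofBlocks g (liftBlk blk ι)) (BlockNorm.ofBlocks g (liftBlk blk ι)) ((fun k => ((-(mulOp (h k) ∘ₗ NL ∘ₗ mulOp (1 - fun p : X × ι => χtX k p.1))) ∘ₗ N k) ∘ₗ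
          (LinearMap.id + (V ∘ₗ stack LinearMap.id (fun j => Sum.elim (fun μ => fgrad n (liftEquiv (τ μ) ι)) (fun μ => bgrad n (liftEquiv (τ μ) ι)) j)) ∘ₗ (projO none ∘ₗ bgPropV (stack (mulOp (fun p : X × ι => χtX k p.1) ∘ₗ N k)
          (fun j => Sum.elim (fun μ => fgrad n (liftEquiv (τ μ) ι)) (fun μ => bgrad n (liftEquiv (τ μ) ι)) j ∘ₗ (mulOp (fun p : X × ι => χtX k p.1) ∘ₗ N k))) V))) k)
      (fun y y' => ind (Sk k) y * ((ε₀ * (1 - (β + (β₁ + ct * β)) * (R * cr) * cr)⁻¹) * Real.exp (-(ρ₃ * g.dist y y')))) := fun k =>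
    (hasMaj_dressedTail_out blk htri hd hrow hσ hβb hR hε₀ hcr hσρ hρ₁V hρ₁G hρ₂ hρ₂₁ hρ₂T (fun _ => rfl) (hG k) (hD k) hV hq (hT k)).mono fun y y' =>
      weight_mul_exp_rate_mono (ind_nonneg _ _) hε' hρ₃₂ (hd y y')
  exact hasMaj_glued_of_cutRows_defect (liftBlk blk ι) Sk htri hd hd0 hrow hσ hB hθ hε' hNov hσρ₃ hhcut hhabs hN hGc hK hE hq'

/-- ★★★ **… AND IS A TWO-SIDED INVERSE OF THE LIVE OPERATOR**: with the same data plus `Σ_k h_k² = 1`, the exact flat locality `M_{h_k}(Σ∇*∇ + W + N_L)N_k = M_{h_k}` and the plateau identity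
`M_{h_k}(Σ∇*∇ + W)M_{1−χ̃_k} = 0`: `𝒢∘Δ_U = 1` and `Δ_U∘𝒢 = 1`, `Δ_U = Σ∇*∇ + W + N_L − V̂∘jet` (file 32 `glued_inverse_of_defect`; per-cube locality-with-defect = file 33
`mulOp_comp_sub_comp_dressedV_tail`; remainder letter = file 32 `hasMaj_remainderD` on the rows above). [cite: Balaban1984PropagatorsII, (2.91) p.239, (2.135)–(2.136) p.247 (mechanism); Balaban1984PropagatorsI, (1.120)–(1.123) p.37] -/
theorem glueInv_smoothCutDressed_inverse (htri : Triangle254 g) (hd : ∀ a b : g.Site, 0 ≤ g.dist a b) (hsymm : ∀ y y', g.dist y y' = g.dist y' y)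
    (hrow : RowSum g σ cr) (hσ : 0 ≤ σ) {ρ₁ ρ₂ ρ₃ ρN ρT δV ε R ε₀ c₁ c₂ θW cN ℓ ω d₁ Nov : ℝ} (hβ : 0 ≤ β) (hβ₁ : 0 ≤ β₁) (hct : 0 ≤ ct) (hR : 0 ≤ R) (hε₀ : 0 ≤ ε₀) (hcr : 0 ≤ cr) (hNov : 0 ≤ Nov) (hσρ : σ ≤ ρ₁) (hρ₁V : ρ₁ ≤ δV)
    (hρ₁G : ρ₁ + σ ≤ δ) (hρ₂ : 0 ≤ ρ₂) (hρ₂₁ : ρ₂ + σ ≤ ρ₁) (hρ₂T : ρ₂ + σ ≤ ρT) (hρ₃ : 0 ≤ ρ₃) (hρ₃₂ : ρ₃ ≤ ρ₂) (hρ₃V : ρ₃ + σ ≤ δV - ε) (hρ₃N : ρ₃ + σ ≤ ρN) (hσρ₃ : 2 * σ ≤ ρ₃)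
    (hε : 0 < ε) (hc₁ : 0 ≤ c₁) (hc₂ : 0 ≤ c₂) (hθW : 0 ≤ θW) (hcN : 0 ≤ cN) (hℓ : 0 ≤ ℓ) (hω : 0 ≤ ω) (hd₁ : 0 ≤ d₁)
    -- per cube: supports, the bump and its insertions (both ways), the input cut-off
    (hSχ : ∀ k x, χX k x ≠ 0 → blk x ∈ Sk k) (hSψ : ∀ k x, ψX k x ≠ 0 → blk x ∈ Sk k) (hχt : ∀ k x, |χtX k x| ≤ 1)
    (hdχt : ∀ k μ p, |fgrad n (liftEquiv (τ μ) ι) (fun p : X × ι => χtX k p.1) p| ≤ ct) (hdχtb : ∀ k μ p, |bgrad n (liftEquiv (τ μ) ι) (fun p : X × ι => χtX k p.1) p| ≤ ct)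
    (hsub : ∀ k, mulOp (fun p : X × ι => χtX k p.1) ∘ₗ mulOp (fun p : X × ι => χX k p.1) = mulOp (fun p : X × ι => χtX k p.1))
    (hχ : ∀ k, mulOp (fun p : X × ι => χX k p.1) ∘ₗ mulOp (fun p : X × ι => χtX k p.1) = mulOp (fun p : X × ι => χtX k p.1))
    (hs : ∀ k μ, mulOp ((fun p : X × ι => χtX k p.1) ∘ (liftEquiv (τ μ) ι)) ∘ₗ mulOp (fun p : X × ι => χX k p.1) = mulOp ((fun p : X × ι => χtX k p.1) ∘ (liftEquiv (τ μ) ι)))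
    (hsb : ∀ k μ, mulOp ((fun p : X × ι => χtX k p.1) ∘ (liftEquiv (τ μ) ι).symm) ∘ₗ mulOp (fun p : X × ι => χX k p.1) = mulOp ((fun p : X × ι => χtX k p.1) ∘ (liftEquiv (τ μ) ι).symm))
    (hdd : ∀ k μ, mulOp (fgrad n (liftEquiv (τ μ) ι) (fun p : X × ι => χtX k p.1)) ∘ₗ mulOp (fun p : X × ι => χX k p.1) = mulOp (fgrad n (liftEquiv (τ μ) ι) (fun p : X × ι => χtX k p.1)))
    (hddb : ∀ k μ, mulOp (bgrad n (liftEquiv (τ μ) ι) (fun p : X × ι => χtX k p.1)) ∘ₗ mulOp (fun p : X × ι => χX k p.1) = mulOp (bgrad n (liftEquiv (τ μ) ι) (fun p : X × ι => χtX k p.1)))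
    (hs' : ∀ k μ, mulOp (fun p : X × ι => χX k p.1) ∘ₗ mulOp ((fun p : X × ι => χtX k p.1) ∘ (liftEquiv (τ μ) ι)) = mulOp ((fun p : X × ι => χtX k p.1) ∘ (liftEquiv (τ μ) ι)))
    (hsb' : ∀ k μ, mulOp (fun p : X × ι => χX k p.1) ∘ₗ mulOp ((fun p : X × ι => χtX k p.1) ∘ (liftEquiv (τ μ) ι).symm) = mulOp ((fun p : X × ι => χtX k p.1) ∘ (liftEquiv (τ μ) ι).symm))
    (hdd' : ∀ k μ, mulOp (fun p : X × ι => χX k p.1) ∘ₗ mulOp (fgrad n (liftEquiv (τ μ) ι) (fun p : X × ι => χtX k p.1)) = mulOp (fgrad n (liftEquiv (τ μ) ι) (fun p : X × ι => χtX k p.1)))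
    (hddb' : ∀ k μ, mulOp (fun p : X × ι => χX k p.1) ∘ₗ mulOp (bgrad n (liftEquiv (τ μ) ι) (fun p : X × ι => χtX k p.1)) = mulOp (bgrad n (liftEquiv (τ μ) ι) (fun p : X × ι => χtX k p.1)))
    (hNψ : ∀ k, N k ∘ₗ mulOp (fun p : X × ι => ψX k p.1) = N k)
    -- per cube: FILE 63's cut rows
    (hcut : ∀ k, HasMaj (BlockNorm.ofBlocks g (liftBlk blk ι)) (BlockNorm.ofBlocks g (liftBlk blk ι)) (mulOp (fun p : X × ι => χX k p.1) ∘ₗ N k) (fun y y' => ind (Sk k) y * ind (Sk k) y' * (β * Real.exp (-(δ * g.dist y y')))))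
    (hcutF : ∀ k μ, HasMaj (BlockNorm.ofBlocks g (liftBlk blk ι)) (BlockNorm.ofBlocks g (liftBlk blk ι)) (mulOp (fun p : X × ι => χX k p.1) ∘ₗ (fgrad n (liftEquiv (τ μ) ι) ∘ₗ N k)) (fun y y' => ind (Sk k) y * ind (Sk k) y' * (β₁ * Real.exp (-(δ * g.dist y y')))))
    (hcutB : ∀ k μ, HasMaj (BlockNorm.ofBlocks g (liftBlk blk ι)) (BlockNorm.ofBlocks g (liftBlk blk ι)) (mulOp (fun p : X × ι => χX k p.1) ∘ₗ (bgrad n (liftEquiv (τ μ) ι) ∘ₗ N k)) (fun y y' => ind (Sk k) y * ind (Sk k) y' * (β₁ * Real.exp (-(δ * g.dist y y')))))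
    -- per cube: the partition (`|h| ≤ 1`, `Σh² = 1`, supported in the cut: `M_hM_χ = M_h`, letters `c₁, c₂`, block reading `hb` with `ℓ, ω`), one-step block distance `d₁`, overlap `N_ov`
    (hhabs : ∀ k p, |h k p| ≤ 1) (h236 : ∀ p, ∑ k, h k p ^ 2 = 1)
    (hh1 : ∀ k μ p, |fgrad n (liftEquiv (τ μ) ι) (h k) p| ≤ c₁) (hh1b : ∀ k μ p, |bgrad n (liftEquiv (τ μ) ι) (h k) p| ≤ c₁) (hh2 : ∀ k μ p, |fgradAdj n (liftEquiv (τ μ) ι) (fgrad n (liftEquiv (τ μ) ι) (h k)) p| ≤ c₂)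
    (hLip : ∀ k y y', |hb k y - hb k y'| ≤ ℓ * g.dist y y') (hrh : ∀ k p, |h k p - hb k (liftBlk blk ι p)| ≤ ω) (hstep : ∀ μ x, g.dist (blk (τ μ x)) (blk x) ≤ d₁)
    (hN : ∀ a, ∑ k, ind (Sk k) a ≤ Nov)
    -- per cube: the exact locality of the FLAT cube for `Δ = D₃ + N_L` on the partition, `M_hD₃M_{1−χ̃} = 0` (range of `D₃` inside the bump's plateau), the tail row (dag-n15-a's images geometry)
    (hloc0 : ∀ k, mulOp (h k) ∘ₗ (lapOp n (fun μ => liftEquiv (τ μ) ι) W + NL) ∘ₗ N k = mulOp (h k))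
    (hL : ∀ k, mulOp (h k) ∘ₗ lapOp n (fun μ => liftEquiv (τ μ) ι) W ∘ₗ mulOp (1 - fun p : X × ι => χtX k p.1) = 0)
    (hT : ∀ k, HasMaj (BlockNorm.ofBlocks g (liftBlk blk ι)) (BlockNorm.ofBlocks g (liftBlk blk ι)) ((-(mulOp (h k) ∘ₗ NL ∘ₗ mulOp (1 - fun p : X × ι => χtX k p.1))) ∘ₗ N k) (fun y y' => ind (Sk k) y * ind (Sk k) y' * (ε₀ * Real.exp (-(ρT * g.dist y y')))))
    -- common: the perturbation `V̂`, smallness, the `W`-rows per cube, the flat nonlocal summand's commutator letters per cube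
    (hV : HasMaj (BlockNorm.ofBlocks g (blkPair (liftBlk blk ι))) (BlockNorm.ofBlocks g (liftBlk blk ι)) V (fun y y' => R * Real.exp (-(δV * g.dist y y'))))
    (hq : (β + (β₁ + ct * β)) * (R * cr) * cr < 1)
    (hW : ∀ k, HasMaj (BlockNorm.ofBlocks g (liftBlk blk ι)) (BlockNorm.ofBlocks g (liftBlk blk ι)) (commOp W (h k) ∘ₗ (projO none ∘ₗ bgPropV (stack (mulOp (fun p : X × ι => χtX k p.1) ∘ₗ N k)
          (fun j => Sum.elim (fun μ => fgrad n (liftEquiv (τ μ) ι)) (fun μ => bgrad n (liftEquiv (τ μ) ι)) j ∘ₗ (mulOp (fun p : X × ι => χtX k p.1) ∘ₗ N k))) V))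
      (fun y y' => ind (Sk k) y * ind (Sk k) y' * (θW * Real.exp (-(ρ₂ * g.dist y y')))))
    (hKN : ∀ k, HasMaj (BlockNorm.ofBlocks g (liftBlk blk ι)) (BlockNorm.ofBlocks g (liftBlk blk ι)) (commOp NL (h k)) (fun y y' => cN * Real.exp (-(ρN * g.dist y y'))))
    (hq' : Nov * ((((Fintype.card J : ℝ) * (c₂ * ((β + (β₁ + ct * β)) * (1 - (β + (β₁ + ct * β)) * (R * cr) * cr)⁻¹) + 2 * (c₁ * ((β + (β₁ + ct * β)) * (1 - (β + (β₁ + ct * β)) * (R * cr) * cr)⁻¹))) + θW + cN * ((β + (β₁ + ct * β)) * (1 - (β + (β₁ + ct * β)) * (R * cr) * cr)⁻¹) * cr)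
          + ((ℓ * (Real.exp 1 * ε)⁻¹ + 2 * (ω + ℓ * d₁)) * R * ((β + (β₁ + ct * β)) * (1 - (β + (β₁ + ct * β)) * (R * cr) * cr)⁻¹) * cr + R * c₁ * ((β + (β₁ + ct * β)) * (1 - (β + (β₁ + ct * β)) * (R * cr) * cr)⁻¹) * cr)) + (ε₀ * (1 - (β + (β₁ + ct * β)) * (R * cr) * cr)⁻¹)) * cr < 1) :
    (glueInv (parametrix h (fun k => projO none ∘ₗ bgPropV (stack (mulOp (fun p : X × ι => χtX k p.1) ∘ₗ N k)
          (fun j => Sum.elim (fun μ => fgrad n (liftEquiv (τ μ) ι)) (fun μ => bgrad n (liftEquiv (τ μ) ι)) j ∘ₗ (mulOp (fun p : X × ι => χtX k p.1) ∘ₗ N k))) V))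
        (remainder (lapOp n (fun μ => liftEquiv (τ μ) ι) W + NL - V ∘ₗ stack LinearMap.id (fun j => Sum.elim (fun μ => fgrad n (liftEquiv (τ μ) ι)) (fun μ => bgrad n (liftEquiv (τ μ) ι)) j)) h (fun k => projO none ∘ₗ bgPropV (stack (mulOp (fun p : X × ι => χtX k p.1) ∘ₗ N k)
          (fun j => Sum.elim (fun μ => fgrad n (liftEquiv (τ μ) ι)) (fun μ => bgrad n (liftEquiv (τ μ) ι)) j ∘ₗ (mulOp (fun p : X × ι => χtX k p.1) ∘ₗ N k))) V)
          - ∑ k, (fun k => ((-(mulOp (h k) ∘ₗ NL ∘ₗ mulOp (1 - fun p : X × ι => χtX k p.1))) ∘ₗ N k) ∘ₗ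
          (LinearMap.id + (V ∘ₗ stack LinearMap.id (fun j => Sum.elim (fun μ => fgrad n (liftEquiv (τ μ) ι)) (fun μ => bgrad n (liftEquiv (τ μ) ι)) j)) ∘ₗ (projO none ∘ₗ bgPropV (stack (mulOp (fun p : X × ι => χtX k p.1) ∘ₗ N k)
          (fun j => Sum.elim (fun μ => fgrad n (liftEquiv (τ μ) ι)) (fun μ => bgrad n (liftEquiv (τ μ) ι)) j ∘ₗ (mulOp (fun p : X × ι => χtX k p.1) ∘ₗ N k))) V))) k ∘ₗ mulOp (h k))) ∘ₗ (lapOp n (fun μ => liftEquiv (τ μ) ι) W + NL - V ∘ₗ stack LinearMap.id (fun j => Sum.elim (fun μ => fgrad n (liftEquiv (τ μ) ι)) (fun μ => bgrad n (liftEquiv (τ μ) ι)) j)) = LinearMap.id ∧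
      (lapOp n (fun μ => liftEquiv (τ μ) ι) W + NL - V ∘ₗ stack LinearMap.id (fun j => Sum.elim (fun μ => fgrad n (liftEquiv (τ μ) ι)) (fun μ => bgrad n (liftEquiv (τ μ) ι)) j)) ∘ₗ (glueInv (parametrix h (fun k => projO none ∘ₗ bgPropV (stack (mulOp (fun p : X × ι => χtX k p.1) ∘ₗ N k)
          (fun j => Sum.elim (fun μ => fgrad n (liftEquiv (τ μ) ι)) (fun μ => bgrad n (liftEquiv (τ μ) ι)) j ∘ₗ (mulOp (fun p : X × ι => χtX k p.1) ∘ₗ N k))) V))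
        (remainder (lapOp n (fun μ => liftEquiv (τ μ) ι) W + NL - V ∘ₗ stack LinearMap.id (fun j => Sum.elim (fun μ => fgrad n (liftEquiv (τ μ) ι)) (fun μ => bgrad n (liftEquiv (τ μ) ι)) j)) h (fun k => projO none ∘ₗ bgPropV (stack (mulOp (fun p : X × ι => χtX k p.1) ∘ₗ N k)
          (fun j => Sum.elim (fun μ => fgrad n (liftEquiv (τ μ) ι)) (fun μ => bgrad n (liftEquiv (τ μ) ι)) j ∘ₗ (mulOp (fun p : X × ι => χtX k p.1) ∘ₗ N k))) V)
          - ∑ k, (fun k => ((-(mulOp (h k) ∘ₗ NL ∘ₗ mulOp (1 - fun p : X × ι => χtX k p.1))) ∘ₗ N k) ∘ₗ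
          (LinearMap.id + (V ∘ₗ stack LinearMap.id (fun j => Sum.elim (fun μ => fgrad n (liftEquiv (τ μ) ι)) (fun μ => bgrad n (liftEquiv (τ μ) ι)) j)) ∘ₗ (projO none ∘ₗ bgPropV (stack (mulOp (fun p : X × ι => χtX k p.1) ∘ₗ N k)
          (fun j => Sum.elim (fun μ => fgrad n (liftEquiv (τ μ) ι)) (fun μ => bgrad n (liftEquiv (τ μ) ι)) j ∘ₗ (mulOp (fun p : X × ι => χtX k p.1) ∘ₗ N k))) V))) k ∘ₗ mulOp (h k))) = LinearMap.id := by
  have hβb : 0 ≤ (β + (β₁ + ct * β)) := by positivity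
  have hqi : 0 ≤ (1 - (β + (β₁ + ct * β)) * (R * cr) * cr)⁻¹ := inv_nonneg.2 (by linarith)
  have hθ : 0 ≤ (((Fintype.card J : ℝ) * (c₂ * ((β + (β₁ + ct * β)) * (1 - (β + (β₁ + ct * β)) * (R * cr) * cr)⁻¹) + 2 * (c₁ * ((β + (β₁ + ct * β)) * (1 - (β + (β₁ + ct * β)) * (R * cr) * cr)⁻¹))) + θW + cN * ((β + (β₁ + ct * β)) * (1 - (β + (β₁ + ct * β)) * (R * cr) * cr)⁻¹) * cr)
          + ((ℓ * (Real.exp 1 * ε)⁻¹ + 2 * (ω + ℓ * d₁)) * R * ((β + (β₁ + ct * β)) * (1 - (β + (β₁ + ct * β)) * (R * cr) * cr)⁻¹) * cr + R * c₁ * ((β + (β₁ + ct * β)) * (1 - (β + (β₁ + ct * β)) * (R * cr) * cr)⁻¹) * cr)) := by positivity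
  have hε' : 0 ≤ (ε₀ * (1 - (β + (β₁ + ct * β)) * (R * cr) * cr)⁻¹) := mul_nonneg hε₀ hqi
  have hθε : 0 ≤ Nov * ((((Fintype.card J : ℝ) * (c₂ * ((β + (β₁ + ct * β)) * (1 - (β + (β₁ + ct * β)) * (R * cr) * cr)⁻¹) + 2 * (c₁ * ((β + (β₁ + ct * β)) * (1 - (β + (β₁ + ct * β)) * (R * cr) * cr)⁻¹))) + θW + cN * ((β + (β₁ + ct * β)) * (1 - (β + (β₁ + ct * β)) * (R * cr) * cr)⁻¹) * cr)
          + ((ℓ * (Real.exp 1 * ε)⁻¹ + 2 * (ω + ℓ * d₁)) * R * ((β + (β₁ + ct * β)) * (1 - (β + (β₁ + ct * β)) * (R * cr) * cr)⁻¹) * cr + R * c₁ * ((β + (β₁ + ct * β)) * (1 - (β + (β₁ + ct * β)) * (R * cr) * cr)⁻¹) * cr)) + (ε₀ * (1 - (β + (β₁ + ct * β)) * (R * cr) * cr)⁻¹)) := by positivity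
  have hσ₃ : σ ≤ ρ₃ := by linarith
  have hG := fun k => hasMaj_smoothCut_flat blk (S := Sk k) hβ hβ₁ hct (hχt k) (hsub k) (hcut k)
  have hD := fun k => hasMaj_jet_smoothCut_flat blk τ n (S := Sk k) hβ hβ₁ hct (hχt k) (hdχt k) (hdχtb k) (hs k) (hsb k) (hdd k) (hddb k) (hcut k) (hcutF k) (hcutB k)
  have hunit := fun k => (hasMaj_dressedV_pair blk htri hd hrow hσ hβb hR hcr hσρ hρ₁V hρ₁G hρ₂ hρ₂₁ (hG k) (hD k) hV hq).1
  -- file 33: the per-cube locality WITH defect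
  have hloc : ∀ k, mulOp (h k) ∘ₗ (lapOp n (fun μ => liftEquiv (τ μ) ι) W + NL - V ∘ₗ stack LinearMap.id (fun j => Sum.elim (fun μ => fgrad n (liftEquiv (τ μ) ι)) (fun μ => bgrad n (liftEquiv (τ μ) ι)) j)) ∘ₗ (projO none ∘ₗ bgPropV (stack (mulOp (fun p : X × ι => χtX k p.1) ∘ₗ N k)
          (fun j => Sum.elim (fun μ => fgrad n (liftEquiv (τ μ) ι)) (fun μ => bgrad n (liftEquiv (τ μ) ι)) j ∘ₗ (mulOp (fun p : X × ι => χtX k p.1) ∘ₗ N k))) V) = mulOp (h k) + (fun k => ((-(mulOp (h k) ∘ₗ NL ∘ₗ mulOp (1 - fun p : X × ι => χtX k p.1))) ∘ₗ N k) ∘ₗ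
          (LinearMap.id + (V ∘ₗ stack LinearMap.id (fun j => Sum.elim (fun μ => fgrad n (liftEquiv (τ μ) ι)) (fun μ => bgrad n (liftEquiv (τ μ) ι)) j)) ∘ₗ (projO none ∘ₗ bgPropV (stack (mulOp (fun p : X × ι => χtX k p.1) ∘ₗ N k)
          (fun j => Sum.elim (fun μ => fgrad n (liftEquiv (τ μ) ι)) (fun μ => bgrad n (liftEquiv (τ μ) ι)) j ∘ₗ (mulOp (fun p : X × ι => χtX k p.1) ∘ₗ N k))) V))) k := fun k =>
    mulOp_comp_sub_comp_dressedV_tail (hloc0 k) rfl (hL k) (fun _ => rfl) (hunit k)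
  have hK : ∀ k, HasMaj (BlockNorm.ofBlocks g (liftBlk blk ι)) (BlockNorm.ofBlocks g (liftBlk blk ι)) (commOp (lapOp n (fun μ => liftEquiv (τ μ) ι) W + NL - V ∘ₗ stack LinearMap.id (fun j => Sum.elim (fun μ => fgrad n (liftEquiv (τ μ) ι)) (fun μ => bgrad n (liftEquiv (τ μ) ι)) j)) (h k) ∘ₗ (projO none ∘ₗ bgPropV (stack (mulOp (fun p : X × ι => χtX k p.1) ∘ₗ N k)
          (fun j => Sum.elim (fun μ => fgrad n (liftEquiv (τ μ) ι)) (fun μ => bgrad n (liftEquiv (τ μ) ι)) j ∘ₗ (mulOp (fun p : X × ι => χtX k p.1) ∘ₗ N k))) V))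
      (fun y y' => ind (Sk k) y' * ((((Fintype.card J : ℝ) * (c₂ * ((β + (β₁ + ct * β)) * (1 - (β + (β₁ + ct * β)) * (R * cr) * cr)⁻¹) + 2 * (c₁ * ((β + (β₁ + ct * β)) * (1 - (β + (β₁ + ct * β)) * (R * cr) * cr)⁻¹))) + θW + cN * ((β + (β₁ + ct * β)) * (1 - (β + (β₁ + ct * β)) * (R * cr) * cr)⁻¹) * cr)
          + ((ℓ * (Real.exp 1 * ε)⁻¹ + 2 * (ω + ℓ * d₁)) * R * ((β + (β₁ + ct * β)) * (1 - (β + (β₁ + ct * β)) * (R * cr) * cr)⁻¹) * cr + R * c₁ * ((β + (β₁ + ct * β)) * (1 - (β + (β₁ + ct * β)) * (R * cr) * cr)⁻¹) * cr)) * Real.exp (-(ρ₃ * g.dist y y')))) := fun k =>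
    hasMaj_commOp_cubeOp_smoothCutDressed_in blk τ n htri hd hsymm hrow hσ hβ hβ₁ hct hR hcr hσρ hρ₁V hρ₁G hρ₂ hρ₂₁ hρ₃ hρ₃₂ hρ₃V hρ₃N hε hc₁ hc₂ hθW hcN hℓ hω hd₁ (hSχ k)
      (hSψ k) (hχt k) (hdχt k) (hdχtb k) (hsub k) (hχ k) (hs k) (hsb k) (hdd k) (hddb k) (hs' k) (hsb' k) (hdd' k) (hddb' k) (hNψ k) (hcut k) (hcutF k) (hcutB k) hV hq
      (hh1 k) (hh1b k) (hh2 k) (hLip k) (hrh k) hstep (hW k) (hKN k)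
  have hE : ∀ k, HasMaj (BlockNorm.ofBlocks g (liftBlk blk ι)) (BlockNorm.ofBlocks g (liftBlk blk ι)) ((fun k => ((-(mulOp (h k) ∘ₗ NL ∘ₗ mulOp (1 - fun p : X × ι => χtX k p.1))) ∘ₗ N k) ∘ₗ
          (LinearMap.id + (V ∘ₗ stack LinearMap.id (fun j => Sum.elim (fun μ => fgrad n (liftEquiv (τ μ) ι)) (fun μ => bgrad n (liftEquiv (τ μ) ι)) j)) ∘ₗ (projO none ∘ₗ bgPropV (stack (mulOp (fun p : X × ι => χtX k p.1) ∘ₗ N k)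
          (fun j => Sum.elim (fun μ => fgrad n (liftEquiv (τ μ) ι)) (fun μ => bgrad n (liftEquiv (τ μ) ι)) j ∘ₗ (mulOp (fun p : X × ι => χtX k p.1) ∘ₗ N k))) V))) k)
      (fun y y' => ind (Sk k) y * ((ε₀ * (1 - (β + (β₁ + ct * β)) * (R * cr) * cr)⁻¹) * Real.exp (-(ρ₃ * g.dist y y')))) := fun k =>
    (hasMaj_dressedTail_out blk htri hd hrow hσ hβb hR hε₀ hcr hσρ hρ₁V hρ₁G hρ₂ hρ₂₁ hρ₂T (fun _ => rfl) (hG k) (hD k) hV hq (hT k)).mono fun y y' =>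
      weight_mul_exp_rate_mono (ind_nonneg _ _) hε' hρ₃₂ (hd y y')
  have hR := hasMaj_remainderD (liftBlk blk ι) Sk hθ hε' hhabs hN hK hE
  exact glued_inverse_of_defect (liftBlk blk ι) hd hrow hθε hσ₃ h236 hloc hR hq'

end Summit.QuantumFields.YangMills.BalabanUVNodes.N15.CurvedSpecies

end
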